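import Summits.Parity.BatemanHorn.Theorems.AlmostPrimeZerosLinearCappedRepulsionTilted

/-!
# The AP tilted majorant, I: de-smoothing and the principal character
(crux stmt-Parity-11291, line `smooth-rough-lattice-acquisition`, class `linₐ`, lead c2)

Everything here is PROVED (theorems only).  Class `linₐ` (`k = 1`, `f = aX + b`, `a ≥ 2`) of the
crux `Summit.Parity.BatemanHorn.Theses.AlmostPrimeZeros.SystemZeroRepulsion` needs the one-sided
Selberg–Delange majorant of `Σ_{n≤x} z^{s(an+b)}` (`s(m) = Σ_{p^v ∥ m} min(v,2)`), which the lead's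
assembly `stub_apTiltedAssembly` obtains character by character.  This file:

* `desmooth` — the de-smoothing step of `tiltedMajorant_of_parts`, isolated: for coefficients
  `‖a(n)‖ ≤ R^{s(n)}`, `h·‖Σ_{n≤y} a(n)‖ ≤ ‖A₁(y+h) − A₁(y)‖ + h·Σ_{y<n≤y+h} R^{s(n)}`
  (`A₁(w) = Σ_{n≤w} a(n)(w − n)`);
* `stub_apCharBoundPrincipal` (registered helper stub) — **the principal character**: from the
  twisted Euler data (statement of `stub_apTwistedEulerData`, taken as a hypothesis so that the
  file composes by name in the skeleton) and the landed `ζ^z` engine `stub_rieszDiffEngine`,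
  short-interval bound `stub_shortIntervalCapped` and Rankin moment `stub_rankinMajorant`:
  `‖Σ_{0<m≤y} χ₀(m) z^{s(m)}‖ ≤ y (log y)^{Re z−1} e^{A(1+‖z−1‖)^{3/2}}` for `y ≥ y₀(q)` and
  `1 + ‖z − 1‖ ≤ log log y / C`.

References: H. L. Montgomery, R. C. Vaughan, *Multiplicative Number Theory I*, CUP 2007, §7.4,
§11.3; G. Tenenbaum, *Introduction to analytic and probabilistic number theory*, II.5.
-/

noncomputable section

namespace Summit.Parity.BatemanHorn.Cruxes.SystemZeroRepulsion.NearFar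

open scoped BigOperators
open Literature.NumberTheory.LFunctions
open Summit.Parity.BatemanHorn.Cruxes.LinearCappedRepulsion.JensenStieltjesMajorant

/-! ### De-smoothing -/

/-- **De-smoothing a difference of Riesz means.**  For coefficients with `‖a(n)‖ ≤ R^{s(n)}`,
`y ∈ ℕ` and `h > 0`: `A₁(y+h) − A₁(y) = h·Σ_{0<n≤y} a(n) + Σ_{y<n≤y+h} a(n)(y + h − n)` with
`|y + h − n| ≤ h` on the second range, whence
`h·‖Σ_{0<n≤y} a(n)‖ ≤ ‖A₁(y+h) − A₁(y)‖ + h·Σ_{y<n≤⌊y+h⌋} R^{s(n)}`. -/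
theorem desmooth {a : ℕ → ℂ} {R : ℝ} (ha : ∀ n, ‖a n‖ ≤ R ^ (n.factorization.sum fun _ v => min v 2))
    {y : ℕ} {h D₁ S₁ : ℝ} (hh : 0 < h)
    (hD : ‖(∑ n ∈ Finset.Ioc 0 ⌊(y : ℝ) + h⌋₊, a n * ((((y : ℝ) + h : ℝ) : ℂ) - n)) -
        ∑ n ∈ Finset.Ioc 0 ⌊(y : ℝ)⌋₊, a n * (((y : ℝ) : ℂ) - n)‖ ≤ D₁)
    (hS : ∑ n ∈ Finset.Ioc y ⌊(y : ℝ) + h⌋₊, R ^ (n.factorization.sum fun _ v => min v 2) ≤ S₁) :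
    h * ‖∑ n ∈ Finset.Ioc 0 y, a n‖ ≤ D₁ + h * S₁ := by
  set sfun : ℕ → ℕ := fun n => n.factorization.sum fun _ v => min v 2 with hsfun
  set m : ℕ := ⌊(y : ℝ) + h⌋₊ with hmdef
  have hy0 : (0 : ℝ) ≤ y := Nat.cast_nonneg y
  have hxm : y ≤ m := by rw [hmdef]; exact Nat.le_floor (by linarith)
  have hmxh : (m : ℝ) ≤ y + h := Nat.floor_le (by positivity)
  have hfloorx : ⌊(y : ℝ)⌋₊ = y := Nat.floor_natCast y
  set Ax : ℂ := ∑ n ∈ Finset.Ioc 0 y, a n with hAxdef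
  set E : ℂ := ∑ n ∈ Finset.Ioc y m, a n * ((((y : ℝ) + h : ℝ) : ℂ) - n) with hEdef
  have hdecomp : (∑ n ∈ Finset.Ioc 0 m, a n * ((((y : ℝ) + h : ℝ) : ℂ) - n)) -
      ∑ n ∈ Finset.Ioc 0 ⌊(y : ℝ)⌋₊, a n * (((y : ℝ) : ℂ) - n) = (h : ℂ) * Ax + E := by
    rw [hfloorx, ← Finset.sum_Ioc_consecutive _ (Nat.zero_le y) hxm, hAxdef, hEdef, Finset.mul_sum,
      add_sub_right_comm, ← Finset.sum_sub_distrib]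
    congr 1
    refine Finset.sum_congr rfl fun n _ => ?_
    push_cast
    ring
  have hE : ‖E‖ ≤ h * S₁ := by
    have hterm : ∀ n ∈ Finset.Ioc y m, ‖a n * ((((y : ℝ) + h : ℝ) : ℂ) - n)‖ ≤ R ^ sfun n * h := by
      intro n hn
      rw [Finset.mem_Ioc] at hn
      rw [norm_mul]
      refine mul_le_mul (ha n) ?_ (norm_nonneg _) ?_
      · have hn1 : (y : ℝ) < n := by exact_mod_cast hn.1
        have hn2 : (n : ℝ) ≤ m := by exact_mod_cast hn.2
        have : ((((y : ℝ) + h : ℝ) : ℂ) - n) = ((((y : ℝ) + h - n : ℝ)) : ℂ) := by push_cast; ring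
        rw [this, Complex.norm_real, Real.norm_eq_abs, abs_le]
        constructor <;> linarith
      · exact le_trans (norm_nonneg _) (ha n)
    have hS0 : ∑ n ∈ Finset.Ioc y m, R ^ sfun n ≤ S₁ := by simpa [hmdef, hsfun] using hS
    calc ‖E‖ ≤ ∑ n ∈ Finset.Ioc y m, ‖a n * ((((y : ℝ) + h : ℝ) : ℂ) - n)‖ := norm_sum_le _ _
      _ ≤ ∑ n ∈ Finset.Ioc y m, R ^ sfun n * h := Finset.sum_le_sum hterm
      _ = h * ∑ n ∈ Finset.Ioc y m, R ^ sfun n := by rw [Finset.mul_sum]; simp [mul_comm]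
      _ ≤ h * S₁ := mul_le_mul_of_nonneg_left hS0 hh.le
  have hD' : ‖(h : ℂ) * Ax + E‖ ≤ D₁ := by rw [← hdecomp]; exact hD
  have h1 : ‖(h : ℂ) * Ax‖ = h * ‖Ax‖ := by
    rw [norm_mul, Complex.norm_real, Real.norm_of_nonneg hh.le]
  have h2 : ‖(h : ℂ) * Ax‖ ≤ ‖(h : ℂ) * Ax + E‖ + ‖E‖ := by
    have := norm_sub_le ((h : ℂ) * Ax + E) E
    simpa using this
  rw [← h1]
  linarith

/-! ### Exponent bookkeeping -/

/-- `(1 + R)^{3/2} ≤ 3 R^{3/2}` for `R ≥ 1`. -/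
theorem one_add_rpow_three_halves_le {R : ℝ} (hR : 1 ≤ R) :
    (1 + R) ^ (3 / 2 : ℝ) ≤ 3 * R ^ (3 / 2 : ℝ) := by
  have h21 : 1 + R ≤ 2 * R := by linarith
  have h22 : (1 + R) ^ (3 / 2 : ℝ) ≤ (2 * R) ^ (3 / 2 : ℝ) :=
    Real.rpow_le_rpow (by linarith) h21 (by norm_num)
  have h23 : (2 * R) ^ (3 / 2 : ℝ) = 2 ^ (3 / 2 : ℝ) * R ^ (3 / 2 : ℝ) :=
    Real.mul_rpow (by norm_num) (by linarith)
  have h24 : (2 : ℝ) ^ (3 / 2 : ℝ) ≤ 3 := by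
    have hsq : ((2 : ℝ) ^ (3 / 2 : ℝ)) ^ (2 : ℕ) = 8 := by
      rw [← Real.rpow_natCast, ← Real.rpow_mul (by norm_num)]; norm_num
    have h9 : ((2 : ℝ) ^ (3 / 2 : ℝ)) ^ (2 : ℕ) ≤ 3 ^ (2 : ℕ) := by rw [hsq]; norm_num
    exact (pow_le_pow_iff_left₀ (by positivity) (by norm_num) (by norm_num)).1 h9
  have hR0 : 0 ≤ R ^ (3 / 2 : ℝ) := by positivity
  calc (1 + R) ^ (3 / 2 : ℝ) ≤ 2 ^ (3 / 2 : ℝ) * R ^ (3 / 2 : ℝ) := h22.trans h23.le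
    _ ≤ 3 * R ^ (3 / 2 : ℝ) := by gcongr

/-- `K·e^{u} + 1 ≤ e^{u + K}` for `u ≥ 0` (`e^K ≥ K + 1`, `e^u ≥ 1`). -/
theorem mul_exp_add_one_le {u K : ℝ} (hu : 0 ≤ u) :
    K * Real.exp u + 1 ≤ Real.exp (u + K) := by
  rw [Real.exp_add]
  have h1 : K + 1 ≤ Real.exp K := by linarith [Real.add_one_le_exp K]
  have h2 : 1 ≤ Real.exp u := Real.one_le_exp hu
  nlinarith [Real.exp_pos u, Real.exp_pos K, h1, h2]

/-! ### The principal character -/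

set_option maxHeartbeats 400000 in
/-- **The principal character** (registered helper stub `stub_apCharBoundPrincipal` of the crux):
given the twisted Euler data (the statement of `stub_apTwistedEulerData`), for every `q ≥ 1` there
are `A ≥ 0`, `C > 0`, `y₀` with
`‖Σ_{0<m≤y} χ₀(m) z^{s(m)}‖ ≤ y·(log y)^{Re z − 1}·exp(A(1 + ‖z − 1‖)^{3/2})` for all `y ≥ y₀` and all
`z` with `1 + ‖z − 1‖ ≤ log log y / C`.  Proof: `tiltedMajorant_of_parts` verbatim on the data
`RieszData R (4/5) e^{b(1+R)^{3/2}} z (χ₀ z^{s}) G₁` (`R = 1 + ‖z − 1‖`): the `ζ^z` engine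
`stub_rieszDiffEngine` bounds `A₁(y+h) − A₁(y)`, `h = y e^{−(log log y)³}`, the short sum is
`≤ y (log y)^{−R−1}` (`stub_shortIntervalCapped` + `stub_rankinMajorant`, `‖χ₀(m)z^{s(m)}‖ ≤ R^{s(m)}`),
and `desmooth`. -/
theorem stub_apCharBoundPrincipal :
    (∀ (q : ℕ) [NeZero q] (χ : DirichletCharacter ℂ q), ∃ b : ℝ, 0 ≤ b ∧ ∀ R : ℝ, 0 ≤ R → ∀ z : ℂ, ‖z‖ ≤ R →
      ∃ G : ℂ → ℂ, DifferentiableOn ℂ G {s : ℂ | 1 / 2 < s.re} ∧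
        (∀ s : ℂ, 4 / 5 < s.re → ‖G s‖ ≤ Real.exp (b * (1 + R) ^ (3 / 2 : ℝ))) ∧
        (∀ σ : ℝ, 1 < σ →
          LSeriesSummable (fun n : ℕ => χ (n : ZMod q) * z ^ (n.factorization.sum fun _ v => min v 2)) σ) ∧
        (∀ s : ℂ, 1 < s.re →
          LSeries (fun n : ℕ => χ (n : ZMod q) * z ^ (n.factorization.sum fun _ v => min v 2)) s =
            Complex.exp (z * ∑' p : Nat.Primes, -Complex.log (1 - χ ((p : ℕ) : ZMod q) * ((p : ℕ) : ℂ) ^ (-s))) * G s) ∧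
        (∀ σ : ℝ, 1 < σ → σ ≤ 2 →
          ∑' n : ℕ, ‖LSeries.term (fun n : ℕ => χ (n : ZMod q) * z ^ (n.factorization.sum fun _ v => min v 2)) σ n‖ ≤
            Real.exp (b * (1 + R) ^ (3 / 2 : ℝ)) / (σ - 1) ^ R) ∧
        (χ = 1 → Literature.NumberTheory.LFunctions.SelbergDelange.RieszData R (4 / 5) (Real.exp (b * (1 + R) ^ (3 / 2 : ℝ))) z
          (fun n : ℕ => χ (n : ZMod q) * z ^ (n.factorization.sum fun _ v => min v 2))
          (fun s : ℂ => G s * Complex.exp (z * ∑ p ∈ q.primeFactors, Complex.log (1 - ((p : ℕ) : ℂ) ^ (-s)))))) →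
    ∀ (q : ℕ) [NeZero q], ∃ A : ℝ, 0 ≤ A ∧ ∃ C : ℝ, 0 < C ∧ ∃ y₀ : ℕ, ∀ y : ℕ, y₀ ≤ y → ∀ z : ℂ,
      1 + ‖z - 1‖ ≤ Real.log (Real.log y) / C →
      ‖∑ n ∈ Finset.Ioc 0 y, (1 : DirichletCharacter ℂ q) (n : ZMod q) *
          z ^ (n.factorization.sum fun _ v => min v 2)‖ ≤
        (y : ℝ) * Real.log y ^ (z.re - 1) * Real.exp (A * (1 + ‖z - 1‖) ^ (3 / 2 : ℝ)) := by
  intro hA q _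
  obtain ⟨b, hb0, hEul⟩ := hA q (1 : DirichletCharacter ℂ q)
  obtain ⟨X₀, c, hc0, hEng⟩ := stub_rieszDiffEngine
  obtain ⟨Br, hBr0, hrank⟩ := stub_rankinMajorant
  obtain ⟨C₁, hC₁, x₁, hshort⟩ := stub_shortIntervalCapped Br hBr0 hrank
  -- constants
  set C : ℝ := max C₁ 1 with hCdef
  have hC1 : (1 : ℝ) ≤ C := le_max_right _ _
  have hCC₁ : C₁ ≤ C := le_max_left _ _
  have hC : 0 < C := by linarith
  set A : ℝ := 3 * (b + c) + 2 with hAdef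
  have hA0 : 0 ≤ A := by rw [hAdef]; positivity
  set y₀ : ℕ := max (max x₁ ⌈X₀⌉₊) 3 with hy₀def
  refine ⟨A, hA0, C, hC, y₀, fun y hy z hz => ?_⟩
  -- unpacking the threshold
  have hx₁ : x₁ ≤ y := le_trans ((le_max_left _ _).trans (le_max_left _ _)) hy
  have hX₀ : X₀ ≤ (y : ℝ) :=
    (Nat.le_ceil X₀).trans (by exact_mod_cast ((le_max_right _ _).trans (le_max_left _ _)).trans hy)
  have hy3 : (3 : ℕ) ≤ y := le_trans (le_max_right _ _) hy
  have hypos : (0 : ℝ) < y := by exact_mod_cast (show 0 < y by omega)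
  set 𝓛 : ℝ := Real.log y with h𝓛def
  set L : ℝ := Real.log 𝓛 with hLdef
  -- the radius
  set r : ℝ := ‖z - 1‖ with hrdef
  have hr0 : 0 ≤ r := norm_nonneg _
  set R : ℝ := 1 + r with hRdef
  have hR1 : 1 ≤ R := by rw [hRdef]; linarith
  have hR0 : 0 ≤ R := by linarith
  have hzR : ‖z‖ ≤ R := by
    have h := norm_add_le (z - 1) 1
    simp only [sub_add_cancel, norm_one] at h
    rw [hRdef, hrdef]; linarith
  have hRLC : R ≤ L / C := hz
  have hLC : C ≤ L := by
    have h1 : 1 ≤ L / C := hR1.trans hRLC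
    rwa [le_div_iff₀ hC, one_mul] at h1
  have hL0 : 0 < L := hC.trans_le hLC
  have hRL : R ≤ L := hRLC.trans (div_le_self hL0.le hC1)
  have hRC₁ : R ≤ L / C₁ := hRLC.trans (div_le_div_of_nonneg_left hL0.le hC₁ hCC₁)
  have h𝓛1 : 1 ≤ 𝓛 := by
    rw [h𝓛def, Real.le_log_iff_exp_le hypos]
    have h3 : (3 : ℝ) ≤ y := by exact_mod_cast hy3
    exact (Real.exp_one_lt_d9.le.trans (by norm_num)).trans h3
  have h𝓛pos : 0 < 𝓛 := by linarith
  have hrez' : -r ≤ z.re - 1 := by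
    have h1 : |(z - 1).re| ≤ ‖z - 1‖ := Complex.abs_re_le_norm _
    have h2 : (z - 1).re = z.re - 1 := by simp
    rw [h2] at h1
    rw [hrdef]
    linarith [neg_abs_le (z.re - 1)]
  have hrez : -R ≤ z.re - 1 := by rw [hRdef]; linarith
  -- the data and the engine
  obtain ⟨G, -, -, -, -, -, hRD⟩ := hEul R hR0 z hzR
  have hData := hRD rfl
  set h : ℝ := (y : ℝ) * Real.exp (-(Real.log (Real.log y) ^ 3)) with hhdef
  have hhpos : 0 < h := mul_pos hypos (Real.exp_pos _)
  have hhx : h ≤ y := by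
    have : Real.exp (-(Real.log (Real.log y) ^ 3)) ≤ 1 := by
      rw [Real.exp_le_one_iff, neg_nonpos]; positivity
    calc h = (y : ℝ) * Real.exp (-(Real.log (Real.log y) ^ 3)) := rfl
      _ ≤ (y : ℝ) * 1 := by gcongr
      _ = y := mul_one _
  have hEngx := hEng R _ z _ _ hR1 hData y h hX₀ hRL le_rfl hhx
  -- the short sum
  have hShortx := hshort y hx₁ R hR1 hRC₁
  -- de-smoothing
  set sfun : ℕ → ℕ := fun n => n.factorization.sum fun _ v => min v 2 with hsfun
  set a : ℕ → ℂ := fun n => (1 : DirichletCharacter ℂ q) (n : ZMod q) * z ^ sfun n with hadef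
  have ha : ∀ n, ‖a n‖ ≤ R ^ sfun n := by
    intro n
    rw [hadef]
    simp only [norm_mul, norm_pow]
    calc ‖(1 : DirichletCharacter ℂ q) (n : ZMod q)‖ * ‖z‖ ^ sfun n ≤ 1 * R ^ sfun n :=
          mul_le_mul (DirichletCharacter.norm_le_one _ _) (pow_le_pow_left₀ (norm_nonneg _) hzR _)
            (by positivity) zero_le_one
      _ = R ^ sfun n := one_mul _
  set B : ℝ := Real.exp (b * (1 + R) ^ (3 / 2 : ℝ)) with hBdef
  have hdes := desmooth ha hhpos (D₁ := h * y * 𝓛 ^ (z.re - 1) * B * Real.exp (c * (1 + R) ^ (3 / 2 : ℝ)))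
    (S₁ := (y : ℝ) * 𝓛 ^ (-R - 1)) (by simpa [hadef, hsfun, hhdef] using hEngx)
    (by simpa [hhdef, hsfun] using hShortx)
  -- hence the bound for A(y)
  have h𝓛mono : 𝓛 ^ (-R - 1) ≤ 𝓛 ^ (z.re - 1) :=
    Real.rpow_le_rpow_of_exponent_le h𝓛1 (by linarith)
  set E₁ : ℝ := B * Real.exp (c * (1 + R) ^ (3 / 2 : ℝ)) with hE₁def
  have hE₁ : E₁ = Real.exp ((b + c) * (1 + R) ^ (3 / 2 : ℝ)) := by
    rw [hE₁def, hBdef, ← Real.exp_add]; ring_nf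
  have hAx : ‖∑ n ∈ Finset.Ioc 0 y, a n‖ ≤ (y : ℝ) * 𝓛 ^ (z.re - 1) * (E₁ + 1) := by
    have h3 : h * ‖∑ n ∈ Finset.Ioc 0 y, a n‖ ≤ h * ((y : ℝ) * 𝓛 ^ (z.re - 1) * (E₁ + 1)) := by
      calc h * ‖∑ n ∈ Finset.Ioc 0 y, a n‖
          ≤ h * y * 𝓛 ^ (z.re - 1) * B * Real.exp (c * (1 + R) ^ (3 / 2 : ℝ)) +
              h * ((y : ℝ) * 𝓛 ^ (-R - 1)) := hdes
        _ ≤ h * y * 𝓛 ^ (z.re - 1) * B * Real.exp (c * (1 + R) ^ (3 / 2 : ℝ)) +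
              h * ((y : ℝ) * 𝓛 ^ (z.re - 1)) := by gcongr
        _ = h * ((y : ℝ) * 𝓛 ^ (z.re - 1) * (E₁ + 1)) := by rw [hE₁def]; ring
    exact le_of_mul_le_mul_left h3 hhpos
  -- the constant: `E₁ + 1 ≤ exp(A R^{3/2})`
  have hexpA : E₁ + 1 ≤ Real.exp (A * (1 + r) ^ (3 / 2 : ℝ)) := by
    rw [hE₁, ← hRdef]
    have h1 : (1 : ℝ) ≤ R ^ (3 / 2 : ℝ) := Real.one_le_rpow hR1 (by norm_num)
    have h2 := one_add_rpow_three_halves_le hR1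
    have hbc : 0 ≤ b + c := by positivity
    have h3 : (b + c) * (1 + R) ^ (3 / 2 : ℝ) ≤ 3 * (b + c) * R ^ (3 / 2 : ℝ) := by
      nlinarith [mul_le_mul_of_nonneg_left h2 hbc]
    have h4 := mul_exp_add_one_le (u := 3 * (b + c) * R ^ (3 / 2 : ℝ)) (K := 1) (by positivity)
    rw [one_mul] at h4
    calc Real.exp ((b + c) * (1 + R) ^ (3 / 2 : ℝ)) + 1
        ≤ Real.exp (3 * (b + c) * R ^ (3 / 2 : ℝ)) + 1 := by gcongr
      _ ≤ Real.exp (3 * (b + c) * R ^ (3 / 2 : ℝ) + 1) := h4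
      _ ≤ Real.exp (A * R ^ (3 / 2 : ℝ)) := by
          rw [Real.exp_le_exp, hAdef]; nlinarith
  have hmain : (y : ℝ) * 𝓛 ^ (z.re - 1) * (E₁ + 1) ≤
      (y : ℝ) * 𝓛 ^ (z.re - 1) * Real.exp (A * (1 + r) ^ (3 / 2 : ℝ)) := by
    have : 0 ≤ (y : ℝ) * 𝓛 ^ (z.re - 1) := by positivity
    exact mul_le_mul_of_nonneg_left hexpA this
  simpa [hadef, hsfun] using hAx.trans hmain

end Summit.Parity.BatemanHorn.Cruxes.SystemZeroRepulsion.NearFar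

end
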